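import Summits.ResolutionOfSingularities.ResolutionOfSingularities.Theorems.SyzygyFlatteningGlobalisationDatumBlowup
import Summits.ResolutionOfSingularities.ResolutionOfSingularities.Theorems.SyzygyFlatteningGlobalisationNormalizationStage
import Summits.ResolutionOfSingularities.ResolutionOfSingularities.Theorems.SyzygyFlatteningGlobalisationSyzygyDatumChartAux
import Summits.ResolutionOfSingularities.ResolutionOfSingularities.Theorems.SyzygyFlatteningGlobalisationDatumBlowupStalkAux
import Literature.AlgebraicGeometry.Resolution.BlowupCharts
import HarnessLib

/-!
# Local rings of a glued datum blow-up at the centres of valuations — `stub_datumBlowupStalk`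

Crux `SyzygyFlattening.Globalisation` (stmt-ResolutionOfSingularities-17061), line `birth`,
registered stub `stub_datumBlowupStalk`. Input (the conclusion of the landed `stub_datumBlowup`,
`…GlobalisationDatumBlowup.lean`): a proper model `M` of `K/k`, ideals `N_U ⊆ Γ(M, U)` on the
affine opens, non-zero for non-empty `U`, and `π : Y → M` with `Y` integral, `π` proper and
`π|_{π⁻¹U}` — read through `U ≅ Spec Γ(M, U)` — a blowing up along `Ñ_U` (`IsBlowup`) for every
non-empty affine open `U`. Output: a proper model `M₁ → M` with underlying scheme `Y`, and for
every `v ∈ Zar(K/k)` with centre `x ∈ U` on `M` and every non-zero `u₀ ∈ N_U` of minimal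
`v`-value, the local ring of `M₁` at the centre of `v`, realised in `K`, is
`locAt 𝒪_v (k[sec Γ(M, U), sec N_U / sec u₀])`, the blow-up chart `A[N_U/u₀]` of the chart
`A = sec Γ(M, U) ⊆ K` localised at the centre (`sec : Γ(M, U) → K` = germ at the generic point
followed by `K(M) ≅ K`).

* `datumStalk_exists_isIso_morphismRestrict` — `π` is an isomorphism over a non-empty open of
  `M` (over a non-empty affine `U` it is a blowing up along the non-zero `Ñ_U`, an isomorphism
  off the centre, Stacks 02OS = `IsBlowup.isIso_compl`; the pattern of `IsFBlowup.isBirational`),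
  so `ProperModel.ofModification` packages `Y` as a proper model `M₁ → M`;
* `datumStalk_exists_chartι_of_mem` — a point of `Y` over `U` lies in a chart
  `g : Spec (R[It])_{(bt)} → Y`, `R = Γ(M, U)`, `I = N_U`, `0 ≠ b ∈ I`, an open immersion with
  `g ≫ π = Spec(R → (R[It])_{(bt)}) ≫ (Spec R → M)` (uniqueness of blowing ups against
  `Proj R[It]`, whose charts `D₊(bt)` cover; verbatim `IsBlowup.exists_chartι_of_mem` of
  `BlowupCharts.lean` for the family `N_U` in place of an ideal sheaf);
* `datumStalk_secToK_appLE` — `sec_V^{M₁} ∘ φ^* = sec_U^M` on `Γ(M, U)` for `V ⊆ φ⁻¹U`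
  (`normalizationStage_secToK_app`);
* `datumStalk_range_stalkToK_eq` — THE COMPUTATION for any morphism of proper models
  `φ : M₁ → M` which is such a blowing up over `U ∋ x`: the centre `y` of `v` on `M₁` lies over `x`
  (`Hom.map_centre`), hence in a chart `V = g(Spec C_b)`; by `stub_centreChart` for `M₁` the local
  ring at `y` in `K` is `locAt 𝒪_v A₁` with `A₁ = sec_V Γ(M₁, V) = ψ(C_b)` for the ring map
  `ψ : C_b ≅ Γ(M₁, V) → K`, which extends `sec` (`appLE_appIso_ΓSpecIso_of_comp_eq`), so
  `A₁ = k[sec R, sec I / sec b]` (`datumStalk_range_eq_adjoin`, Aux file); `A₁ ⊆ 𝒪_v` makes `b`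
  of minimal `v`-value too, and two minimal generators give the same localisation at the centre
  (`locAt_adjoin_minors_eq_adjoin_ideal`, the unit `sec b / sec u₀`);
* `stub_datumBlowupStalk` — the registered statement.

Sources: The Stacks Project, Tag 0804 (charts `Spec A[I/a]` of a blowing up) and Tag 02OS;
J. Novacoski, M. Spivakovsky (2014), Def. 2.11 (the chart of a local blowing up selected by a
valuation: a generator of minimal value); Zariski–Samuel II, Ch. VI §17 (local rings of models
inside `K`).
-/

noncomputable section

-- single-problem summit: the doubled namespace component `ResolutionOfSingularities` is forced
set_option linter.dupNamespace false

namespace Summit.ResolutionOfSingularities.ResolutionOfSingularities.Theorems.SyzygyFlattening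

open CategoryTheory AlgebraicGeometry TopologicalSpace
open Literature.AlgebraicGeometry
open Literature.AlgebraicGeometry.Resolution

universe u


/-! ## The glued datum blow-up is an isomorphism over a non-empty open -/

section Charts

variable {Y X : Scheme.{u}} {π : Y ⟶ X}

/-- **A glued datum blow-up is an isomorphism over a non-empty open of the base**: over a
non-empty affine open `U` it is (after `U ≅ Spec Γ(X, U)`) a blowing up along the non-zero
ideal sheaf `Ñ_U`, hence an isomorphism over the non-empty complement of the centre
(`IsBlowup.isIso_compl`, Stacks 02OS), an open of `U`, i.e. of `X`.
[cite: StacksProject, Tag 02OS] -/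
theorem datumStalk_exists_isIso_morphismRestrict [IsIntegral X]
    (N : ∀ U : X.affineOpens, Ideal Γ(X, U))
    (hN : ∀ U : X.affineOpens, ((U : X.Opens) : Set X).Nonempty → N U ≠ ⊥)
    (hπ : ∀ U : X.affineOpens, ((U : X.Opens) : Set X).Nonempty →
      IsBlowup (π ∣_ (U : X.Opens) ≫ U.2.isoSpec.hom) (affineBlowup.idealSheaf (N U))) :
    ∃ W : X.Opens, (W : Set X).Nonempty ∧ IsIso (π ∣_ W) := by
  -- adapted from `IsFBlowup.isBirational` (FBlowup.lean)
  obtain ⟨x⟩ := (inferInstance : Nonempty X)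
  obtain ⟨U₀, hU₀, hxU, -⟩ :=
    exists_isAffineOpen_mem_and_subset (X := X) (x := x) (U := ⊤) (Opens.mem_top _)
  let U : X.affineOpens := ⟨U₀, hU₀⟩
  have hUne : ((U : X.Opens) : Set X).Nonempty := ⟨x, hxU⟩
  have hJ : affineBlowup.idealSheaf (N U) ≠ ⊥ := affineBlowup.idealSheaf_ne_bot (hN U hUne)
  -- `π ∣_ U` is a blowing up of `U` along `Ñ_U` moved to `U`
  have hb' : IsBlowup (π ∣_ (U : X.Opens))
      ((affineBlowup.idealSheaf (N U)).comap U.2.isoSpec.hom) := by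
    have := (hπ U hUne).comp_iso U.2.isoSpec.symm
    rwa [Iso.symm_hom, Iso.symm_inv, Category.assoc, Iso.hom_inv_id, Category.comp_id] at this
  -- hence an isomorphism over the complement `W` of the centre, a non-empty open of `U`
  have h2 : IsIso (π ∣_ (U : X.Opens) ∣_
      centreCompl ((affineBlowup.idealSheaf (N U)).comap U.2.isoSpec.hom)) := hb'.isIso_compl
  have h3 : IsIso (π ∣_ ((U : X.Opens).ι ''ᵁ
      centreCompl ((affineBlowup.idealSheaf (N U)).comap U.2.isoSpec.hom))) :=
    ((MorphismProperty.isomorphisms Scheme).arrow_mk_iso_iff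
      (morphismRestrictRestrict π (U : X.Opens) _)).mp h2
  have hWne : ((centreCompl ((affineBlowup.idealSheaf (N U)).comap U.2.isoSpec.hom) :
      (U : X.Opens).toScheme.Opens) : Set (U : X.Opens)).Nonempty := by
    obtain ⟨s, hs⟩ := centreCompl_nonempty hJ
    refine ⟨U.2.isoSpec.inv s, ?_⟩
    have hs' : s ∉ ((affineBlowup.idealSheaf (N U)).support : Set (Spec Γ(X, U))) := hs
    have heq : U.2.isoSpec.hom (U.2.isoSpec.inv s) = s :=
      U.2.isoSpec.schemeIsoToHomeo.apply_symm_apply s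
    change U.2.isoSpec.inv s ∉
      ((((affineBlowup.idealSheaf (N U)).comap U.2.isoSpec.hom)).support : Set (U : X.Opens))
    rw [Scheme.IdealSheafData.support_comap]
    change ¬ (U.2.isoSpec.hom (U.2.isoSpec.inv s) ∈
      ((affineBlowup.idealSheaf (N U)).support : Set (Spec Γ(X, U))))
    rwa [heq]
  refine ⟨_, ?_, h3⟩
  obtain ⟨s, hs⟩ := hWne
  exact ⟨(U : X.Opens).ι s, s, hs, rfl⟩

/-- **The charts `Spec (R[It])_{(bt)}` of a glued datum blow-up over an affine open `U ∋ π y`**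
(`R = Γ(X, U)`, `I = N_U`, `0 ≠ b ∈ I`): `y` lies in the image of an open immersion
`g : Spec (R[It])_{(bt)} → Y` with `g ≫ π = Spec (R → (R[It])_{(bt)}) ≫ (Spec R → X)`
(uniqueness of blowing ups against `Proj R[It]`, covered by the `D₊(bt)`; `b ≠ 0` since `bt`
does not vanish at the point). [cite: StacksProject, Tag 0804] -/
theorem datumStalk_exists_chartι_of_mem (U : X.affineOpens) (I : Ideal Γ(X, U))
    (hb : IsBlowup (π ∣_ (U : X.Opens) ≫ U.2.isoSpec.hom) (affineBlowup.idealSheaf I))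
    {y : Y} (hy : π y ∈ (U : X.Opens)) :
    ∃ (b : Γ(X, U)) (hbI : b ∈ I)
      (g : Spec (.of (HomogeneousLocalization.Away (reesGrading I) (reesT b hbI))) ⟶ Y),
      b ≠ 0 ∧ IsOpenImmersion g ∧ y ∈ Set.range g ∧
        g ≫ π = Spec.map (CommRingCat.ofHom (reesChartBase b hbI)) ≫ U.2.fromSpec := by
  -- adapted from `IsBlowup.exists_chartι_of_mem` (BlowupCharts.lean)
  classical
  obtain ⟨ε, -, hε'⟩ := hb.unique (affineBlowup.isBlowup I)
  -- the chart containing the point over `y`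
  have hy' : ε.hom ⟨y, hy⟩ ∈ (⊤ : (affineBlowup I).Opens) := trivial
  rw [← affineBlowup.iSup_basicOpen_reesT_eq_top I] at hy'
  obtain ⟨⟨b, hbI⟩, hyb⟩ := Opens.mem_iSup.mp hy'
  have hb0 : b ≠ 0 := by
    rintro rfl
    rw [Proj.mem_basicOpen] at hyb
    apply hyb
    have h0 : reesT (I := I) 0 hbI = 0 := Subtype.ext (by simp [coe_reesT])
    rw [h0]
    exact Ideal.zero_mem (HomogeneousIdeal.toIdeal _)
  refine ⟨b, hbI, affineBlowup.chartι b hbI ≫ ε.inv ≫ (π ⁻¹ᵁ (U : X.Opens)).ι, hb0,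
    inferInstance, ?_, ?_⟩
  · -- `y` is in the image
    have hyb' : ε.hom ⟨y, hy⟩ ∈ affineBlowup.chartι b hbI ''ᵁ ⊤ := by
      rwa [affineBlowup.image_top_chartι]
    obtain ⟨z, -, hz⟩ := hyb'
    replace hz : affineBlowup.chartι b hbI z = ε.hom ⟨y, hy⟩ := hz
    refine ⟨z, ?_⟩
    rw [Scheme.Hom.comp_apply, hz, ← Scheme.Hom.comp_apply, Iso.hom_inv_id_assoc]
    rfl
  · -- `g ≫ π = Spec φ_b ≫ (Spec R → X)`
    rw [Category.assoc, Category.assoc, ← morphismRestrict_ι, ← U.2.isoSpec_hom_fromSpec,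
      ← affineBlowup.chartι_π b hbI, ← hε']
    simp only [Category.assoc]

end Charts

/-! ## Sections in `K` along a morphism of proper models, on smaller opens -/

section Model

variable {k K : Type u} [Field k] [Field K] [Algebra k K]

/-- **`sec_V^N ∘ φ^* = sec_U^M`** for a morphism of proper models `φ : N → M`, an open `U` of `M`
and an open `V ⊆ φ⁻¹U` of `N` containing the generic point (`normalizationStage_secToK_app` and
restriction of germs). [cite: ZariskiSamuel1960, Ch. VI §17] -/
theorem datumStalk_secToK_appLE {N M : ProperModel k K} (φ : N.Hom M) {U : M.X.Opens}
    (hU' : genericPoint M.X ∈ U) {V : N.X.Opens} (hV' : genericPoint N.X ∈ V)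
    (hVU : V ≤ φ.f ⁻¹ᵁ U) (f : Γ(M.X, U)) :
    (N.X.presheaf.germ V (genericPoint N.X) hV' ≫ N.funFieldIso.hom).hom
        ((φ.f.appLE U V hVU).hom f) =
      (M.X.presheaf.germ U (genericPoint M.X) hU' ≫ M.funFieldIso.hom).hom f := by
  rw [← normalizationStage_secToK_app φ hU' (hVU hV') f]
  change N.funFieldIso.hom.hom ((N.X.presheaf.germ V (genericPoint N.X) hV').hom
      ((N.X.presheaf.map (homOfLE hVU).op).hom ((φ.f.app U).hom f))) =
    N.funFieldIso.hom.hom ((N.X.presheaf.germ (φ.f ⁻¹ᵁ U) (genericPoint N.X) (hVU hV')).hom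
      ((φ.f.app U).hom f))
  rw [TopCat.Presheaf.germ_res_apply]

end Model

/-! ## The local ring upstairs at the centre of a valuation -/

section Stalk

variable {k K : Type} [Field k] [Field K] [Algebra k K]

/-- **The local ring of a datum blow-up at the centre of a valuation.** Let `φ : M₁ → M` be a
morphism of proper models of `K/k` which over the affine open `U ∋ x = centre_M(v)` is a
blowing up along `Ĩ` (`IsBlowup (φ|_U ≫ (U ≅ Spec Γ(M, U))) Ĩ`), `sec : Γ(M, U) → K` the
sections read in `K`, and `u₀ ∈ I` non-zero of minimal `v`-value. Then the local ring of `M₁`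
at `centre_{M₁}(v)`, realised in `K`, is `locAt 𝒪_v (k[sec Γ(M, U), sec I / sec u₀])`: the
centre upstairs lies over `x`, in a chart `V = Spec (R[It])_{(bt)}`; its local ring is
`locAt 𝒪_v A₁` for the chart `A₁ = sec_V Γ(M₁, V) = k[sec R, sec I / sec b]` (`stub_centreChart`,
`datumStalk_range_eq_adjoin`); `A₁ ⊆ 𝒪_v` makes `b` minimal and
`locAt 𝒪_v (k[sec R, sec I / sec b]) = locAt 𝒪_v (k[sec R, sec I / sec u₀])`
(`locAt_adjoin_minors_eq_adjoin_ideal`).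
[cite: StacksProject, Tag 0804; NovacoskiSpivakovsky2014, Def. 2.11] -/
theorem datumStalk_range_stalkToK_eq {M₁ M : ProperModel k K} (φ : M₁.Hom M)
    (v : ZariskiRiemannSpace k K) {U : M.X.Opens} (hU : IsAffineOpen U) (hx : M.centre v ∈ U)
    (I : Ideal Γ(M.X, U))
    (hbl : IsBlowup (φ.f ∣_ U ≫ hU.isoSpec.hom) (affineBlowup.idealSheaf I))
    (sec : Γ(M.X, U) →+* K)
    (hsec : ∀ f, sec f = (M.X.presheaf.germ U (genericPoint M.X)
      (centreChart_genericPoint_mem hx) ≫ M.funFieldIso.hom).hom f)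
    {u₀ : Γ(M.X, U)} (hu₀ : u₀ ∈ I) (hu₀0 : u₀ ≠ 0)
    (hmin : ∀ n ∈ I, v.asValuationSubring.valuation (sec n) ≤
      v.asValuationSubring.valuation (sec u₀)) :
    ((M₁.X.presheaf.stalkSpecializes (genericPoint_specializes (M₁.centre v)) ≫
        M₁.funFieldIso.hom).hom).range =
      (locAt v.asValuationSubring (Algebra.adjoin k
        (Set.range sec ∪ {y : K | ∃ n ∈ I, y = sec n * (sec u₀)⁻¹}))).toSubring := by
  have hU' : genericPoint M.X ∈ U := centreChart_genericPoint_mem hx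
  -- `sec` is injective and `k ⊆ im sec`
  have hsec' : sec = (M.X.presheaf.germ U (genericPoint M.X) hU' ≫ M.funFieldIso.hom).hom :=
    RingHom.ext hsec
  have hinj : Function.Injective sec := by
    rw [hsec']
    exact normalizationStage_secToK_injective M hU'
  have hk : ∀ c : k, algebraMap k K c ∈ Set.range sec := fun c =>
    ⟨(M.π.appLE ⊤ U le_top).hom ((Scheme.ΓSpecIso (.of k)).inv.hom c), by
      rw [hsec]; exact centreChart_secToK_algebraMap M U hU' c⟩
  have hsu0 : sec u₀ ≠ 0 := fun h => hu₀0 (hinj (by rw [h, map_zero]))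
  -- the centre upstairs lies over `x`, in a chart `g : Spec (R[It])_{(bt)} → M₁`
  have hy : φ.f (M₁.centre v) ∈ U := by
    rw [φ.map_centre]
    exact hx
  obtain ⟨b, hbI, g, hb0, hg, ⟨z, hz⟩, hgπ⟩ :=
    datumStalk_exists_chartι_of_mem (π := φ.f) ⟨U, hU⟩ I hbl hy
  haveI := hg
  have hVU : g ''ᵁ ⊤ ≤ φ.f ⁻¹ᵁ U :=
    image_top_le_preimage_of_comp_eq φ.f g ⟨U, hU⟩ _ hgπ
  have hV : IsAffineOpen (g ''ᵁ ⊤) := (isAffineOpen_top _).image_of_isOpenImmersion g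
  have hyV : M₁.centre v ∈ g ''ᵁ ⊤ := ⟨z, trivial, hz⟩
  have hV' : genericPoint M₁.X ∈ g ''ᵁ ⊤ := centreChart_genericPoint_mem hyV
  -- the chart dictionary upstairs: the local ring at the centre is `locAt O A₁`
  obtain ⟨-, A₁, hA₁c, -, -, hA₁O, hA₁loc⟩ := stub_centreChart k K M₁ v (g ''ᵁ ⊤) hV hyV
  have hA₁r := normalizationStage_toSubring_eq_secRange M₁ hyV A₁ hA₁c
  rw [← hA₁loc]
  -- the sections of the chart read in `K`: `ψ : (R[It])_{(bt)} ≅ Γ(M₁, V) → K` extends `sec`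
  let eR : Γ(M₁.X, g ''ᵁ ⊤) ≃+* HomogeneousLocalization.Away (reesGrading I) (reesT b hbI) :=
    ((g.appIso ⊤) ≪≫ Scheme.ΓSpecIso
      (.of (HomogeneousLocalization.Away (reesGrading I) (reesT b hbI)))).commRingCatIsoToRingEquiv
  have key := appLE_appIso_ΓSpecIso_of_comp_eq φ.f g ⟨U, hU⟩
    (CommRingCat.ofHom (reesChartBase b hbI)) hgπ hVU
  have k0 : ∀ r, eR ((φ.f.appLE U (g ''ᵁ ⊤) hVU).hom r) = reesChartBase b hbI r := fun r =>
    congrArg (fun h : Γ(M.X, U) ⟶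
      CommRingCat.of (HomogeneousLocalization.Away (reesGrading I) (reesT b hbI)) => h.hom r) key
  let ψ : HomogeneousLocalization.Away (reesGrading I) (reesT b hbI) →+* K :=
    (M₁.X.presheaf.germ (g ''ᵁ ⊤) (genericPoint M₁.X) hV' ≫ M₁.funFieldIso.hom).hom.comp
      eR.symm.toRingHom
  have hψ : ∀ r, ψ (reesChartBase b hbI r) = sec r := fun r =>
    calc ψ (reesChartBase b hbI r)
        = (M₁.X.presheaf.germ (g ''ᵁ ⊤) (genericPoint M₁.X) hV' ≫ M₁.funFieldIso.hom).hom
            ((φ.f.appLE U (g ''ᵁ ⊤) hVU).hom r) :=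
          congrArg
            (M₁.X.presheaf.germ (g ''ᵁ ⊤) (genericPoint M₁.X) hV' ≫ M₁.funFieldIso.hom).hom
            (eR.symm_apply_eq.mpr (k0 r).symm)
      _ = (M.X.presheaf.germ U (genericPoint M.X) hU' ≫ M.funFieldIso.hom).hom r :=
          datumStalk_secToK_appLE φ hU' hV' hVU r
      _ = sec r := (hsec r).symm
  have hrange : Set.range ψ = Set.range
      (M₁.X.presheaf.germ (g ''ᵁ ⊤) (genericPoint M₁.X) hV' ≫ M₁.funFieldIso.hom).hom := by
    ext y
    constructor
    · rintro ⟨c, rfl⟩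
      exact ⟨eR.symm c, rfl⟩
    · rintro ⟨s, rfl⟩
      exact ⟨eR s, congrArg
        (M₁.X.presheaf.germ (g ''ᵁ ⊤) (genericPoint M₁.X) hV' ≫ M₁.funFieldIso.hom).hom
        (eR.symm_apply_apply s)⟩
  have hsb0 : sec b ≠ 0 := fun h => hb0 (hinj (by rw [h, map_zero]))
  -- so `A₁ = k[sec R, sec I / sec b]`
  have hA₁ : A₁ =
      Algebra.adjoin k (Set.range sec ∪ {y : K | ∃ n ∈ I, y = sec n * (sec b)⁻¹}) := by
    apply SetLike.ext'
    calc (A₁ : Set K) = (A₁.toSubring : Set K) := rfl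
      _ = Set.range (M₁.X.presheaf.germ (g ''ᵁ ⊤) (genericPoint M₁.X) hV' ≫
            M₁.funFieldIso.hom).hom :=
          (congrArg (fun S : Subring K => (S : Set K)) hA₁r).trans (RingHom.coe_range _)
      _ = Set.range ψ := hrange.symm
      _ = _ := datumStalk_range_eq_adjoin b hbI sec hsb0 hk ψ hψ
  -- minimality of `b` (the chart lies in `O`) and of `u₀`; the switch of minimal generators
  rw [hA₁] at hA₁O
  have hkO : ∀ c : k, algebraMap k K c ∈ v.asValuationSubring := fun c =>
    hA₁O (Subalgebra.algebraMap_mem _ c)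
  have hSA : Set.range sec ⊆ v.asValuationSubring := fun y hy =>
    hA₁O (Algebra.subset_adjoin (Or.inl hy))
  have hminB : ∀ n ∈ I, sec n * (sec b)⁻¹ ∈ v.asValuationSubring := fun n hn =>
    hA₁O (Algebra.subset_adjoin (Or.inr ⟨n, hn, rfl⟩))
  have hminU : ∀ n ∈ I, sec n * (sec u₀)⁻¹ ∈ v.asValuationSubring := fun n hn => by
    have hv0 : v.asValuationSubring.valuation (sec u₀) ≠ 0 := by simpa using hsu0
    rw [← div_eq_mul_inv, ← v.asValuationSubring.valuation_le_one_iff, map_div₀,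
      div_le_one₀ (pos_iff_ne_zero.mpr hv0)]
    exact hmin n hn
  have hswitch : locAt v.asValuationSubring
        (Algebra.adjoin k (Set.range sec ∪ {y : K | ∃ g : I, y = sec g * (sec b)⁻¹})) =
      locAt v.asValuationSubring
        (Algebra.adjoin k (Set.range sec ∪ {y : K | ∃ n ∈ I, y = sec n * (sec u₀)⁻¹})) :=
    locAt_adjoin_minors_eq_adjoin_ideal v.asValuationSubring hkO hSA (fun g : I => sec g)
      ⟨b, hbI⟩ hsb0 (fun g => hminB g g.2) sec I u₀ hu₀ hsu0 hminU (fun _ _ h g => h g g.2)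
      (fun _ _ h n hn => h ⟨n, hn⟩)
  have hset : {y : K | ∃ g : I, y = sec g * (sec b)⁻¹} =
      {y : K | ∃ n ∈ I, y = sec n * (sec b)⁻¹} := by
    ext y
    constructor
    · rintro ⟨g, rfl⟩
      exact ⟨g, g.2, rfl⟩
    · rintro ⟨n, hn, rfl⟩
      exact ⟨⟨n, hn⟩, rfl⟩
  rw [hset] at hswitch
  rw [hA₁, hswitch]

end Stalk

/-! ## The registered stub -/

/-- **STUB `stub_datumBlowupStalk` (local rings of a glued datum blow-up at centres).** For a
family of ideals `N_U ⊆ Γ(M, U)` (non-zero on non-empty affine `U`) and a glued blow-up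
`π : Y → M` (`Y` integral, `π` proper, `IsBlowup` along `Ñ_U` over every non-empty affine `U` —
the conclusion of `stub_datumBlowup`): `π` is an isomorphism over a non-empty open
(`datumStalk_exists_isIso_morphismRestrict`), so `Y` is a proper model `M₁ → M`
(`ProperModel.ofModification`), and for `v` with centre `x ∈ U` on `M` and any non-zero
`u₀ ∈ N_U` of minimal `v`-value, the local ring of `M₁` at the centre of `v`, realised in `K`,
is `locAt 𝒪_v (A[N_U/u₀])` (`datumStalk_range_stalkToK_eq`: the centre lies in some chart
`D₊(bt) ≅ Spec A[N_U/b]` of `π⁻¹U ≅ Bl_{N_U} Spec A`, its local ring is that chart ring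
localised at the centre by `stub_centreChart` for `M₁`, `𝒪_v ⊇ A[N_U/b]` forces `b` minimal,
and two minimal `b, u₀` give the same localisation).
[cite: StacksProject, Tag 0804; NovacoskiSpivakovsky2014, Def. 2.11] -/
theorem stub_datumBlowupStalk : ∀ (k K : Type) [Field k] [Field K] [Algebra k K]
    (M : ProperModel k K) (N : ∀ U : M.X.affineOpens, Ideal Γ(M.X, U)) (Y : Scheme.{0})
    (π : Y ⟶ M.X),
      IsIntegral Y → IsProper π →
      (∀ U : M.X.affineOpens, ((U : M.X.Opens) : Set M.X).Nonempty → N U ≠ ⊥) →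
      (∀ U : M.X.affineOpens, ((U : M.X.Opens) : Set M.X).Nonempty →
        IsBlowup (π ∣_ (U : M.X.Opens) ≫ U.2.isoSpec.hom) (affineBlowup.idealSheaf (N U))) →
      ∃ (M₁ : ProperModel k K) (_ : M₁.Hom M),
        ∀ (v : ZariskiRiemannSpace k K) (U : M.X.Opens) (hU : IsAffineOpen U)
          (hx : M.centre v ∈ U) (u₀ : Γ(M.X, U)), u₀ ∈ N ⟨U, hU⟩ → u₀ ≠ 0 →
          (∀ n ∈ N ⟨U, hU⟩,
            v.asValuationSubring.valuation
                ((((M.X.presheaf.stalkSpecializes (genericPoint_specializes (M.centre v)) ≫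
                  M.funFieldIso.hom).hom).comp (M.X.presheaf.germ U (M.centre v) hx).hom) n) ≤
              v.asValuationSubring.valuation
                ((((M.X.presheaf.stalkSpecializes (genericPoint_specializes (M.centre v)) ≫
                  M.funFieldIso.hom).hom).comp (M.X.presheaf.germ U (M.centre v) hx).hom) u₀)) →
          ((M₁.X.presheaf.stalkSpecializes (genericPoint_specializes (M₁.centre v)) ≫
              M₁.funFieldIso.hom).hom).range =
            (locAt v.asValuationSubring (Algebra.adjoin k
              (Set.range
                  (((M.X.presheaf.stalkSpecializes (genericPoint_specializes (M.centre v)) ≫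
                    M.funFieldIso.hom).hom).comp (M.X.presheaf.germ U (M.centre v) hx).hom) ∪
                {y : K | ∃ n ∈ N ⟨U, hU⟩, y =
                  (((M.X.presheaf.stalkSpecializes (genericPoint_specializes (M.centre v)) ≫
                      M.funFieldIso.hom).hom).comp (M.X.presheaf.germ U (M.centre v) hx).hom) n *
                    ((((M.X.presheaf.stalkSpecializes (genericPoint_specializes (M.centre v)) ≫
                      M.funFieldIso.hom).hom).comp (M.X.presheaf.germ U (M.centre v) hx).hom)
                      u₀)⁻¹}))).toSubring := by
  intro k K _ _ _ M N Y π hY hπ hN hblow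
  haveI := hY
  haveI := hπ
  obtain ⟨W, hWne, hWiso⟩ := datumStalk_exists_isIso_morphismRestrict N hN hblow
  haveI := hWiso
  refine ⟨ProperModel.ofModification M π W hWne, ProperModel.ofModificationHom M π W hWne, ?_⟩
  intro v U hU hx u₀ hu₀ hu₀0 hmin
  exact datumStalk_range_stalkToK_eq (ProperModel.ofModificationHom M π W hWne) v hU hx
    (N ⟨U, hU⟩) (hblow ⟨U, hU⟩ ⟨_, hx⟩) _ (fun f => centreChart_stalkToK_germ M hx f) hu₀ hu₀0
    hmin

end Summit.ResolutionOfSingularities.ResolutionOfSingularities.Theorems.SyzygyFlattening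

end
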